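import Mathlib.Probability.Kernel.MeasurableLIntegral
import Mathlib.Probability.Kernel.Composition.MapComap
import Mathlib.MeasureTheory.Function.Floor
import Mathlib.MeasureTheory.Constructions.BorelSpace.Metric
import Mathlib.Analysis.Normed.Group.Basic
import Literature.Probability.Process.PointStationaryLaw
import HarnessLib

/-!
# Everything shows at the root: transfer of almost-sure properties under point-stationary laws

Sequel of `PointStationaryLaw.lean` (its "NOT here" list: the "root a.s. ⇒ every point a.s."
transfer). For a law `P : Measure (Measure E)` of rooted configurations satisfying the Mecke /
mass-transport identity (`IsPointStationaryLaw P`) and carried by LOCALLY FINITE configurations,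
every `P`-almost sure property of the rooted configuration holds `P`-almost surely for the
configuration re-rooted at each of its points simultaneously
(`IsPointStationaryLaw.ae_forall_map_sub`). This is the point-process form of the Aldous–Lyons
lemma "everything shows at the root" for unimodular random rooted networks
[AldousLyons2007, Lemma 2.3]: a root-invariant event of probability zero at the root has
probability zero at every vertex.

* `exists_isSFiniteKernel_apply_eq_self` — measurability device: for a countable measurable
  partition `A` of `α` there is an s-FINITE kernel `κ : Kernel (Measure α) α` with `κ μ = μ`
  whenever every `μ (A n)` is finite (the identity kernel itself is not s-finite). It makes
  Mathlib's kernel measurability API (`Measurable.lintegral_kernel_prod_right`,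
  `Kernel.measurable_kernel_prodMk_left`) available for Campbell-type integrals
  `μ ↦ ∫⁻ y, f μ y ∂μ` on locally finite configurations.
* `measurable_map_sub_kernel` — joint measurability of the re-rooting `(μ, y) ↦ θ_y (κ μ)`.
* `IsPointStationaryLaw.ae_forall_map_sub` — the transfer lemma. Proof: mass transport with
  `g (ν, z) = 1[ν ∈ B']`, `B'` a measurable `P`-null superset of the bad event (so NO
  measurability of the property is required): the mass sent from the root vanishes a.s., hence
  so does the mass received, `Σ_{y ∈ μ} 1[θ_y μ ∈ B']`, which is a.e.-measurable by the device.

Local finiteness is phrased through the norm shells `{z | ⌊‖z‖⌋₊ = n}` of a normed group `E`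
(`measurableSet_floorNorm_preimage`); hard-core configurations of a proper space are locally
finite (`RootedHardCoreConfig.lean`, `LocalConfig.finite_inter_of_separated`).

## References
* D. Aldous, R. Lyons, *Processes on unimodular random networks*, EJP 12 (2007), §2,
  Lemma 2.3. [AldousLyons2007]
* G. Last, H. Thorisson, *Invariant transports of stationary random measures and
  mass-stationarity*, Ann. Probab. 37 (2009). [LastThorisson2009]
-/

noncomputable section

open scoped ENNReal
open _root_.MeasureTheory _root_.MeasureTheory.Measure _root_.ProbabilityTheory Set Filter

namespace Literature.Probability.Process

/-! ### An s-finite kernel that is the identity on locally finite measures -/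

section Kernel

/-- **An s-finite kernel that is the identity on locally finite measures.** Given a countable
measurable partition `A` of `α`, there is an s-finite kernel `κ` from `Measure α` (Giry σ-algebra)
to `α` with `κ μ = μ` for every `μ` giving finite mass to every cell. (The identity
`Measure α → Measure α` is a kernel but not s-finite; `κ` cuts each cell off at its integer mass
level, `κ = Σ_{n,m} 1[μ (A n) < ∞, ⌊μ (A n)⌋ = m] · μ|_(A n)`, a countable sum of finite kernels.)
[folklore] -/
theorem exists_isSFiniteKernel_apply_eq_self {α : Type*} [MeasurableSpace α] (A : ℕ → Set α)
    (hA : ∀ n, MeasurableSet (A n)) (hdisj : Pairwise (Function.onFun Disjoint A))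
    (hcov : ∀ x, ∃ n, x ∈ A n) :
    ∃ κ : Kernel (Measure α) α, IsSFiniteKernel κ ∧
      ∀ μ : Measure α, (∀ n, μ (A n) < ∞) → κ μ = μ := by
  classical
  have hmeas_restrict : ∀ n, Measurable fun μ : Measure α => μ.restrict (A n) := fun n =>
    Measure.measurable_of_measurable_coe _ fun s hs => by
      simp_rw [Measure.restrict_apply hs]
      exact Measure.measurable_coe (hs.inter (hA n))
  have hmeas_lev : ∀ n m : ℕ,
      MeasurableSet {μ : Measure α | μ (A n) < ∞ ∧ ⌊(μ (A n)).toReal⌋₊ = m} := fun n m =>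
    (measurableSet_lt (Measure.measurable_coe (hA n)) measurable_const).inter
      ((Nat.measurable_floor.comp (Measure.measurable_coe (hA n)).ennreal_toReal)
        (measurableSet_singleton m))
  let κ : ℕ → ℕ → Kernel (Measure α) α := fun n m =>
    { toFun := fun μ => if μ (A n) < ∞ ∧ ⌊(μ (A n)).toReal⌋₊ = m then μ.restrict (A n) else 0
      measurable' := Measurable.ite (hmeas_lev n m) (hmeas_restrict n) measurable_const }
  have hκ_apply : ∀ n m μ, κ n m μ =
      if μ (A n) < ∞ ∧ ⌊(μ (A n)).toReal⌋₊ = m then μ.restrict (A n) else 0 := fun n m μ => rfl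
  have hfin : ∀ n m, IsFiniteKernel (κ n m) := by
    intro n m
    refine ⟨⟨(m : ℝ≥0∞) + 1, by simp, fun μ => ?_⟩⟩
    rw [hκ_apply]
    split_ifs with h
    · rw [Measure.restrict_apply_univ]
      obtain ⟨hlt, hfl⟩ := h
      have h1 : (μ (A n)).toReal < m + 1 := hfl ▸ Nat.lt_floor_add_one _
      rw [← ENNReal.ofReal_toReal hlt.ne]
      have h3 : ENNReal.ofReal ((m : ℝ) + 1) = (m : ℝ≥0∞) + 1 := by
        rw [ENNReal.ofReal_add (by positivity) zero_le_one, ENNReal.ofReal_natCast,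
          ENNReal.ofReal_one]
      rw [← h3]
      exact ((ENNReal.ofReal_lt_ofReal_iff (by positivity)).2 h1).le
    · simp
  haveI : ∀ p : ℕ × ℕ, IsFiniteKernel (κ p.1 p.2) := fun p => hfin p.1 p.2
  refine ⟨Kernel.sum fun p : ℕ × ℕ => κ p.1 p.2, inferInstance, fun μ hμ => ?_⟩
  ext s hs
  rw [Kernel.sum_apply, Measure.sum_apply _ hs, ENNReal.tsum_prod']
  have hinner : ∀ n, ∑' m, (κ n m μ) s = μ (s ∩ A n) := by
    intro n
    have hterm : ∀ m, (κ n m μ) s = if m = ⌊(μ (A n)).toReal⌋₊ then μ (s ∩ A n) else 0 := by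
      intro m
      rw [hκ_apply]
      by_cases h : m = ⌊(μ (A n)).toReal⌋₊
      · rw [if_pos ⟨hμ n, h.symm⟩, if_pos h, Measure.restrict_apply hs]
      · rw [if_neg (fun h' => h h'.2.symm), if_neg h, Measure.coe_zero, Pi.zero_apply]
    simp_rw [hterm]
    exact tsum_ite_eq _ _
  simp_rw [hinner]
  have hd : Pairwise (Function.onFun Disjoint fun n => s ∩ A n) := fun i j hij =>
    (hdisj hij).mono inter_subset_right inter_subset_right
  rw [← measure_iUnion hd fun n => hs.inter (hA n), ← inter_iUnion,
    iUnion_eq_univ_iff.2 hcov, inter_univ]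

variable {E : Type*} [MeasurableSpace E] [Sub E] [MeasurableSub₂ E]

/-- For an s-finite kernel `κ` from configurations to points, the re-rooting map
`(μ, y) ↦ θ_y (κ μ) = (κ μ).map (· - y)` is jointly measurable (Giry σ-algebra on both sides):
its evaluation at a measurable `s` is `κ μ {z | z - y ∈ s}`, a section measure of the s-finite
kernel `Kernel.prodMkRight E κ`. [folklore] -/
theorem measurable_map_sub_kernel (κ : Kernel (Measure E) E) [IsSFiniteKernel κ] :
    Measurable fun p : Measure E × E => (κ p.1).map (fun z => z - p.2) := by
  refine Measure.measurable_of_measurable_coe _ fun s hs => ?_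
  have ht : MeasurableSet {q : (Measure E × E) × E | q.2 - q.1.2 ∈ s} :=
    (measurable_snd.sub (measurable_snd.comp measurable_fst)) hs
  have heq : (fun p : Measure E × E => (κ p.1).map (fun z => z - p.2) s) = fun p =>
      Kernel.prodMkRight E κ p (Prod.mk p ⁻¹' {q : (Measure E × E) × E | q.2 - q.1.2 ∈ s}) := by
    funext p
    rw [Measure.map_apply (measurable_sub_const p.2) hs, Kernel.prodMkRight_apply]
    rfl
  rw [heq]
  exact Kernel.measurable_kernel_prodMk_left ht

end Kernel

/-! ### Everything shows at the root -/

section Transfer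

variable {E : Type*} [NormedAddCommGroup E]

/-- The norm shell `{⌊‖z‖⌋₊ = n}` lies in the closed ball `B̄(0, n + 1)`. [folklore] -/
theorem floorNorm_preimage_subset_closedBall (n : ℕ) :
    (fun z : E => ⌊‖z‖⌋₊) ⁻¹' {n} ⊆ Metric.closedBall (0 : E) ((n : ℝ) + 1) := by
  intro z hz
  refine mem_closedBall_zero_iff.2 ?_
  have h1 : (⌊‖z‖⌋₊ : ℝ) = n := by exact_mod_cast hz
  have h2 := Nat.lt_floor_add_one ‖z‖
  linarith

variable [MeasurableSpace E] [BorelSpace E]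

/-- The norm shells `{z | ⌊‖z‖⌋₊ = n}` (a countable partition of `E` into bounded pieces) are
measurable. [folklore] -/
theorem measurableSet_floorNorm_preimage (n : ℕ) :
    MeasurableSet ((fun z : E => ⌊‖z‖⌋₊) ⁻¹' {n}) :=
  (Nat.measurable_floor.comp measurable_norm) (measurableSet_singleton n)

variable [SecondCountableTopology E]

/-- **Everything shows at the root** (Aldous–Lyons "root a.s. ⇒ every point a.s."): let `P` be a
point-stationary law of configurations `μ : Measure E` (Mecke / mass-transport identity) carried
by locally finite configurations (finite mass on every norm shell). If a property `p` holds for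
`P`-a.e. ROOTED configuration, then `P`-a.s. it holds for the configuration RE-ROOTED AT EVERY
ONE OF ITS POINTS: `p (θ_y μ)` for all `y` with `μ {y} ≠ 0`. Proof: mass transport with
`g (ν, z) = 1[ν ∈ B']`, `B' ⊇ {¬ p}` a measurable `P`-null set (no measurability of `p` is
needed): the mass sent from the root is `0` a.s., so the mass received,
`Σ_{y ∈ μ} 1[θ_y μ ∈ B']` — an a.e.-measurable function of `μ` by
`exists_isSFiniteKernel_apply_eq_self` — vanishes a.s. Point-process (Palm / point-stationary)
form of the Aldous–Lyons lemma for unimodular random rooted networks (AldousLyons2007, §2,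
Lemma 2.3); for Palm versions of stationary point processes this is the standard "a Palm-null
event is seen from no point" principle (LastThorisson2009). [folklore] -/
theorem IsPointStationaryLaw.ae_forall_map_sub {P : Measure (Measure E)}
    (hP : IsPointStationaryLaw P)
    (hlf : ∀ᵐ μ ∂P, ∀ n : ℕ, μ ((fun z : E => ⌊‖z‖⌋₊) ⁻¹' {n}) < ∞)
    {p : Measure E → Prop} (hp : ∀ᵐ μ ∂P, p μ) :
    ∀ᵐ μ ∂P, ∀ y : E, μ {y} ≠ 0 → p (Measure.map (fun z => z - y) μ) := by
  -- a measurable null superset `B'` of the bad event `{¬ p}`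
  obtain ⟨B', hBB', hB'm, hPB'⟩ := exists_measurable_superset_of_null (ae_iff.1 hp)
  -- an s-finite kernel agreeing with the identity on locally finite configurations
  obtain ⟨κ, hκ, hκid⟩ := exists_isSFiniteKernel_apply_eq_self
    (fun n : ℕ => (fun z : E => ⌊‖z‖⌋₊) ⁻¹' {n}) measurableSet_floorNorm_preimage
    (fun i j hij => Set.disjoint_iff.2 fun z hz => hij (hz.1.symm.trans hz.2))
    (fun z => ⟨⌊‖z‖⌋₊, rfl⟩)
  -- mass transport with `g (ν, z) = 1[ν ∈ B']`: nothing is sent, a.s.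
  set g : Measure E → E → ℝ≥0∞ := fun ν _ => B'.indicator 1 ν with hg_def
  have hg : Measurable (Function.uncurry g) :=
    (measurable_one.indicator hB'm).comp measurable_fst
  have hL : ∫⁻ μ, ∫⁻ y, g μ y ∂μ ∂P = 0 := by
    refine (lintegral_congr_ae ?_).trans lintegral_zero
    filter_upwards [measure_eq_zero_iff_ae_notMem.1 hPB'] with μ hμ
    simp [hg_def, Set.indicator_of_notMem hμ]
  -- hence nothing is received, in `P`-mean
  have hR : ∫⁻ μ, ∫⁻ y, g (Measure.map (fun z => z - y) μ) (-y) ∂μ ∂P = 0 := by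
    rwa [hP g hg] at hL
  -- the received mass is a.e.-measurable (a kernel integral on locally finite `μ`)
  have hF' : Measurable fun μ : Measure E =>
      ∫⁻ y, B'.indicator (1 : Measure E → ℝ≥0∞) ((κ μ).map (fun z => z - y)) ∂(κ μ) :=
    Measurable.lintegral_kernel_prod_right
      ((measurable_one.indicator hB'm).comp (measurable_map_sub_kernel κ))
  have hFae : AEMeasurable (fun μ : Measure E =>
      ∫⁻ y, g (Measure.map (fun z => z - y) μ) (-y) ∂μ) P := by
    refine ⟨_, hF', ?_⟩
    filter_upwards [hlf] with μ hμ
    simp only [hg_def, hκid μ hμ]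
  -- so it vanishes a.s., i.e. no point `y` of `μ` has `θ_y μ ∈ B'`
  have hF0 := (lintegral_eq_zero_iff' hFae).1 hR
  filter_upwards [hF0] with μ hμ y hy
  by_contra hnot
  have h1 : g (Measure.map (fun z => z - y) μ) (-y) * μ {y} ≤ 0 := by
    calc g (Measure.map (fun z => z - y) μ) (-y) * μ {y}
        = ∫⁻ z in {y}, g (Measure.map (fun w => w - z) μ) (-z) ∂μ :=
          (lintegral_singleton (fun z => g (Measure.map (fun w => w - z) μ) (-z)) y).symm
      _ ≤ ∫⁻ z, g (Measure.map (fun w => w - z) μ) (-z) ∂μ := setLIntegral_le_lintegral _ _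
      _ = 0 := hμ
  have h2 : g (Measure.map (fun z => z - y) μ) (-y) = 1 := by
    simp [hg_def, Set.indicator_of_mem (hBB' hnot)]
  rw [h2, one_mul] at h1
  exact hy (nonpos_iff_eq_zero.1 h1)

/-- **Everything shows at the root, set form**: under a point-stationary law carried by locally
finite configurations, a `P`-null event `B` of the rooted configuration is simultaneously
avoided by the configuration re-rooted at every one of its points, `P`-a.s. (AldousLyons2007,
Lemma 2.3, point-process form.) [folklore] -/
theorem IsPointStationaryLaw.ae_forall_map_sub_notMem {P : Measure (Measure E)}
    (hP : IsPointStationaryLaw P)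
    (hlf : ∀ᵐ μ ∂P, ∀ n : ℕ, μ ((fun z : E => ⌊‖z‖⌋₊) ⁻¹' {n}) < ∞)
    {B : Set (Measure E)} (hB : P B = 0) :
    ∀ᵐ μ ∂P, ∀ y : E, μ {y} ≠ 0 → Measure.map (fun z => z - y) μ ∉ B :=
  hP.ae_forall_map_sub hlf (measure_eq_zero_iff_ae_notMem.1 hB)

end Transfer

end Literature.Probability.Process
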